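/-
Copyright (c) 2026 the pub-hodgecm-mathlib formalisation cell (harness21).  Prover seat hodgecm-mathlib-K2E4-p06 (g2), Track B ∕ K2-LIT (build stream 29),
h413 = `stmt-HodgeConjecture-24833`, ‹S› road J (K2E3-plan (g1) BATCH #3 22:57:30Z; this seat = the assembly hand): the VALUE-DETERMINATION STEP — every global
transfer takes, at the `H`-central point, the value of any LOCAL solution of the transfer identity there, given the local density (B_loc).  2026-09-03.
-/
import Literature.NumberTheory.Rogawski1990.TamagawaSingularMembersFinTFCovol   -- ★ p844690: the letters' vocabulary (`IsLocalDeltaTransfer`, `LocalTransferFactor`, `stableOrbitalIntegralRel`, …)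
import Literature.NumberTheory.Automorphic.LocalEndoscopicOrbitClosed            -- ★ `UnitaryGroup.localStableOrbitalIntegralH_add_of_isLocalGRegular` (H-side additivity on `C_c` at `G`-regular points)
import Literature.NumberTheory.Rogawski1990.RankOneEulerPoincareGlue             -- ★ `IsLocSmooth.const_smul` (+ ★ `IsLocSmooth.add` via `LocalTransferGlue`)
import HarnessLib

/-!
# h413 ∕ Track B «K2-LIT», ‹S› road J — VALUE DETERMINATION AT THE CENTRE: local identity + local density (B_loc) ⇒ every global transfer has the local value (helper)

Cell `pub/hodgecm-mathlib`, crux H413 = `stmt-HodgeConjecture-24833`, route `HCCMUnconditional`; dealer-of-record K2E3-plan (g1) (BATCH #3 22:57:30Z: ‹S›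
`sig_K2E3SingularTransferSigned` by ROAD J = ★ S1 dress value (J1, K2E4-p08) + EP value (J2♯) + compatible-measure identity (J3, K2E4-p04) + density (J4); the assembly
`Theorems/K2E3SingularTransferSigned…OfRoadJ.lean` is this seat's).  THEOREMS ONLY (no `def`, no `instance`, no `notation`, no `sorry`, default heartbeats); count-neutral.

THE STEP (interface finding 23:06:06Z).  Road J's engine, the ★ S1 dress `exists_nhds_stableOrbitalIntegralRel_eq_of_central_singular_of_compactSide`, produces a smooth
`φ^H` satisfying the transfer identity (4.3.1) only for the `G`-regular `γ` NEAR the central `ε_H = (γ_H)_v` (J1 adds the VALUE `φ^H(ε_H)`).  ‹S› speaks of EVERY smooth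
global `Δ‴_v`-transfer pair `(fH, f)`.  The bridge: `gH := fH + (−1)•φ^H ∈ C_c^∞(H_v)` has `Φ^st_H(γ, gH) = Φ^st_H(γ, fH) − Φ^st_H(γ, φ^H) = 0` for the `G`-regular `γ` near
`ε_H` (H-side additivity on `C_c` at `G`-regular points, ★ `UnitaryGroup.localStableOrbitalIntegralH_add_of_isLocalGRegular`, for a family admissible on the `G`-regular
classes — a conjunct of `IsLocalTransferDatum`; homogeneity ★ `stableOrbitalIntegralRel_smul_fun`), so the LOCAL density (B_loc) (cand socket
`sig_K2E3CentralTransferVanishingLocal`, `K2/K2E4-p06/g2/…cand…`, ★ `Theorems/K2E3CentralTransferVanishingLocal` p855519) gives `gH(ε_H) = 0`, i.e. `fH(ε_H) = φ^H(ε_H)`.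
(The GLOBAL density U3b-a (B_v) would NOT suffice: orbits through a point-neighbourhood of the central `ε_H` are unbounded, no cutoff makes `(gH, 0)` a global transfer pair.)
* `transfer_apply_eq_of_local_identity` — frame-light, explicit binders (place data `Δv, mHv, mGv`, the point `h0`, (B_loc)'s conclusion AT `h0` as the hypothesis `hB`):
  `fH h0 = φH h0`.  Road J's assembly then reads `c·fH(ε_H)` off J1's value formula for `φ^H(ε_H)`, J2♯'s sign and J3's measure identity.
[Rogawski1990 §8.2 Prop. 8.2.1 (a) pp. 117–118 («F(γ₀) − F′(γ₀′)», cf. §4.12); §4.3 (4.3.1) p. 43; HarishChandra1999AdmissibleDistributions Thm. 3.1.]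
HONEST LABEL: HC_CM is proved only modulo the 7 printed citations (2 remaining named inputs: hLiu418 = stmt-HodgeConjecture-24832, h413 = stmt-HodgeConjecture-24833) until rung 0
closes; this file is an implication — (B_loc) at the point is a hypothesis.

## References
* [Rogawski1990] J. D. Rogawski, *Automorphic Representations of Unitary Groups in Three Variables*, Ann. of Math. Stud. 123 (1990): §8.2 Prop. 8.2.1 (a) pp. 117–118;
  §4.12 Lemma 4.12.1 p. 67; §4.3 (4.3.1) p. 43.
* [HarishChandra1999AdmissibleDistributions] Harish-Chandra (DeBacker–Sally), *Admissible Invariant Distributions on Reductive p-adic Groups*, AMS ULS 16 (1999), Thm. 3.1.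
-/

set_option autoImplicit false
set_option linter.dupNamespace false

noncomputable section

open Filter Topology
open MeasureTheory Measure NumberField IsDedekindDomain
open Literature.NumberTheory.Rogawski1990 Literature.NumberTheory.Automorphic
open scoped Matrix MatrixGroups

namespace Summit.HodgeConjecture.HodgeConjecture.Cruxes.H413.K2E3TransferValueAtCentreOfLocalIdentity

/-- **VALUE DETERMINATION AT THE CENTRE.**  At a finite place `v`, for ANY local factor `Δv`, an H-family `mHv` admissible on the `G`-regular classes and any `G′`-family
`mGv`: if (B_loc) holds at the point `h0 ∈ H_v` (`hB`: a smooth `gH` whose stable orbital integrals vanish at the `G`-regular points near `h0` vanishes at `h0`), `(fH, f)`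
is a smooth GLOBAL `Δv`-transfer pair, and the smooth `φH` satisfies the transfer identity against the same `f` at the `G`-regular points NEAR `h0`, then `fH h0 = φH h0`.
Proof: `gH := fH + (−1)•φH` is smooth; at a `G`-regular `γ` near `h0`, `Φ^st_H(γ, gH) = Φ^st_H(γ, fH) + (−1)·Φ^st_H(γ, φH) = Σ_c Δ·Φ(c, f) − Σ_c Δ·Φ(c, f) = 0`
(★ `UnitaryGroup.localStableOrbitalIntegralH_add_of_isLocalGRegular`, ★ `stableOrbitalIntegralRel_smul_fun`, ★ `isLocalDeltaTransfer_iff`); `hB` gives `gH h0 = 0`.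
[cite: Rogawski1990, §8.2 Prop. 8.2.1 (a) pp. 117–118; §4.3 (4.3.1) p. 43] [cite: HarishChandra1999AdmissibleDistributions, Thm. 3.1] -/
theorem transfer_apply_eq_of_local_identity
    (L : Type) [Field L] [NumberField L] [IsCMField L] (H' : Matrix (Fin 3) (Fin 3) L) (v : HeightOneSpectrum (𝓞 ↥(maximalRealSubfield L)))
    [MeasurableSpace ((UnitaryGroup.cmDatum L 2 (Matrix.of fun i j : Fin 2 => if i.val + j.val + 1 = 2 then (1 : L) else 0)).Local v × (UnitaryGroup.cmDatum L 1 (Matrix.of fun i j : Fin 1 => if i.val + j.val + 1 = 1 then (1 : L) else 0)).Local v)]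
    [BorelSpace ((UnitaryGroup.cmDatum L 2 (Matrix.of fun i j : Fin 2 => if i.val + j.val + 1 = 2 then (1 : L) else 0)).Local v × (UnitaryGroup.cmDatum L 1 (Matrix.of fun i j : Fin 1 => if i.val + j.val + 1 = 1 then (1 : L) else 0)).Local v)]
    [∀ a : (UnitaryGroup.cmDatum L 2 (Matrix.of fun i j : Fin 2 => if i.val + j.val + 1 = 2 then (1 : L) else 0)).Local v × (UnitaryGroup.cmDatum L 1 (Matrix.of fun i j : Fin 1 => if i.val + j.val + 1 = 1 then (1 : L) else 0)).Local v,
      MeasurableSpace (((UnitaryGroup.cmDatum L 2 (Matrix.of fun i j : Fin 2 => if i.val + j.val + 1 = 2 then (1 : L) else 0)).Local v × (UnitaryGroup.cmDatum L 1 (Matrix.of fun i j : Fin 1 => if i.val + j.val + 1 = 1 then (1 : L) else 0)).Local v) ⧸ Subgroup.centralizer ({a} : Set ((UnitaryGroup.cmDatum L 2 (Matrix.of fun i j : Fin 2 => if i.val + j.val + 1 = 2 then (1 : L) else 0)).Local v × (UnitaryGroup.cmDatum L 1 (Matrix.of fun i j : Fin 1 => if i.val + j.val + 1 = 1 then (1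 : L) else 0)).Local v)))]
    [∀ a : (UnitaryGroup.cmDatum L 2 (Matrix.of fun i j : Fin 2 => if i.val + j.val + 1 = 2 then (1 : L) else 0)).Local v × (UnitaryGroup.cmDatum L 1 (Matrix.of fun i j : Fin 1 => if i.val + j.val + 1 = 1 then (1 : L) else 0)).Local v,
      BorelSpace (((UnitaryGroup.cmDatum L 2 (Matrix.of fun i j : Fin 2 => if i.val + j.val + 1 = 2 then (1 : L) else 0)).Local v × (UnitaryGroup.cmDatum L 1 (Matrix.of fun i j : Fin 1 => if i.val + j.val + 1 = 1 then (1 : L) else 0)).Local v) ⧸ Subgroup.centralizer ({a} : Set ((UnitaryGroup.cmDatum L 2 (Matrix.of fun i j : Fin 2 => if i.val + j.val + 1 = 2 then (1 : L) else 0)).Local v × (UnitaryGroup.cmDatum L 1 (Matrix.of fun i j : Fin 1 => if i.val + j.val + 1 = 1 then (1 : L) else 0)).Local v)))]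
    [∀ γ : (UnitaryGroup.cmDatum L 3 H').Local v, MeasurableSpace ((UnitaryGroup.cmDatum L 3 H').Local v ⧸ Subgroup.centralizer ({γ} : Set ((UnitaryGroup.cmDatum L 3 H').Local v)))]
    (Δv : LocalTransferFactor L H' v)
    {mHv : OrbitalMeasureFamily ((UnitaryGroup.cmDatum L 2 (Matrix.of fun i j : Fin 2 => if i.val + j.val + 1 = 2 then (1 : L) else 0)).Local v × (UnitaryGroup.cmDatum L 1 (Matrix.of fun i j : Fin 1 => if i.val + j.val + 1 = 1 then (1 : L) else 0)).Local v)}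
    (hmH : mHv.IsAdmissibleOn (IsLocalGRegular L v)) (mGv : OrbitalMeasureFamily ((UnitaryGroup.cmDatum L 3 H').Local v))
    (h0 : (UnitaryGroup.cmDatum L 2 (Matrix.of fun i j : Fin 2 => if i.val + j.val + 1 = 2 then (1 : L) else 0)).Local v × (UnitaryGroup.cmDatum L 1 (Matrix.of fun i j : Fin 1 => if i.val + j.val + 1 = 1 then (1 : L) else 0)).Local v)
    (hB : ∀ gH : (UnitaryGroup.cmDatum L 2 (Matrix.of fun i j : Fin 2 => if i.val + j.val + 1 = 2 then (1 : L) else 0)).Local v × (UnitaryGroup.cmDatum L 1 (Matrix.of fun i j : Fin 1 => if i.val + j.val + 1 = 1 then (1 : L) else 0)).Local v → ℂ,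
      IsLocSmooth gH →
      (∀ᶠ γ in 𝓝[{γ | IsLocalGRegular L v γ}] h0, stableOrbitalIntegralRel (IsLocalStablyConjH L v) mHv gH γ = 0) → gH h0 = 0)
    {fH φH : (UnitaryGroup.cmDatum L 2 (Matrix.of fun i j : Fin 2 => if i.val + j.val + 1 = 2 then (1 : L) else 0)).Local v × (UnitaryGroup.cmDatum L 1 (Matrix.of fun i j : Fin 1 => if i.val + j.val + 1 = 1 then (1 : L) else 0)).Local v → ℂ}
    {f : (UnitaryGroup.cmDatum L 3 H').Local v → ℂ}
    (hfH : IsLocSmooth fH) (hφH : IsLocSmooth φH) (htr : IsLocalDeltaTransfer L H' v Δv mHv mGv fH f)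
    (hloc : ∀ᶠ γ in 𝓝[{γ | IsLocalGRegular L v γ}] h0,
      stableOrbitalIntegralRel (IsLocalStablyConjH L v) mHv φH γ =
        ∑ᶠ c : ConjClasses ((UnitaryGroup.cmDatum L 3 H').Local v), Δv.Δ γ (Quotient.out c) * classOrbitalIntegral mGv f c) :
    fH h0 = φH h0 := by
  have hψ : IsLocSmooth ((-1 : ℂ) • φH) := hφH.const_smul (-1)
  have hgH : IsLocSmooth (fH + (-1 : ℂ) • φH) := hfH.add hψ
  have hzero : ∀ᶠ γ in 𝓝[{γ | IsLocalGRegular L v γ}] h0,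
      stableOrbitalIntegralRel (IsLocalStablyConjH L v) mHv (fH + (-1 : ℂ) • φH) γ = 0 := by
    filter_upwards [hloc, eventually_mem_nhdsWithin] with γ h1 h2
    rw [UnitaryGroup.localStableOrbitalIntegralH_add_of_isLocalGRegular L v γ h2 hmH hfH.continuous hfH.hasCompactSupport hψ.continuous hψ.hasCompactSupport,
      stableOrbitalIntegralRel_smul_fun _ mHv (-1 : ℂ) φH γ, (isLocalDeltaTransfer_iff L H' v Δv mHv mGv fH f).1 htr γ h2, h1]
    ring
  have h := hB _ hgH hzero
  simp only [Pi.add_apply, Pi.smul_apply, smul_eq_mul] at h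
  linear_combination h

end Summit.HodgeConjecture.HodgeConjecture.Cruxes.H413.K2E3TransferValueAtCentreOfLocalIdentity

end
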